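import Mathlib
import Summits.ValiantsHypothesis.ValiantsHypothesis.Theorems.BarrierLeverPartitionMinorsHitByVPSimplexJoinThreeSlots
import Summits.ValiantsHypothesis.ValiantsHypothesis.Theorems.BarrierLeverPartitionMinorsHitByVPSimplexJoinFourSlots
import Summits.ValiantsHypothesis.ValiantsHypothesis.Theorems.BarrierLeverPartitionMinorsHitByVPSimplexJoinSixSlots
import Summits.ValiantsHypothesis.ValiantsHypothesis.Theorems.BarrierLeverPartitionMinorsHitByVPSimplexJoinTwoLive
import Summits.ValiantsHypothesis.ValiantsHypothesis.Theorems.BarrierLeverPartitionMinorsHitByVPHiddenStatesUniversalConstraints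

/-!
# Route BarrierLever — item `PartitionMinorsHitByVP` (19717): `Stmt.pieceKill`, the DEEP cases with ≥ 3 live slots
Helper file (`--supports stmt-ValiantsHypothesis-19717`; cell valiant-natproofs, 𝒟-side door (c), line `hidden_states`, uniform-menu
lane; prover seat val-np-p3 gen 12). Definition-free; closes NO item. The DEEP half of the ≥ 3-live-slot part of the case map toward
`Stmt.pieceKill H₀` / `Stmt.pieceKillMany H₀` (memo val-np-p3 g12 §2(f)): at `A = univ` the `n ≤ (2h)²((2h)²+1)+1 ≤ C(h,5)` smallest rows all
have size `≤ 5` (`smallRowsUniv_props`, `n_le_choose_five`), so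
* **`pieceKill_sixLive`** — six or more live slots (`6 ≤ #{f : (S 0 f).Nonempty}`): the six-slot lemma (p632746) with all levels 0;
* **`pieceKill_deep3` / `pieceKill_deep4` / `pieceKill_deep5`** — 3 / 4 / 5 distinct slots deep at levels `m_f` (at `univ`) with
  `Σ (m_f + 1) ≥ 6`: the 3/4/5-slot lemmas (p631390 / p631847 / p632360) on rows of size `≤ Σ m_f + (k−1)`.
What then remains of `Stmt.pieceKillMany`: pieces with 3–5 live slots whose levels at `univ` sum (with +1 each) to ≤ 5 — the shallow patterns
(0,0,0), (1,0,0), (1,1,0), (2,0,0), (0,0,0,0), (1,0,0,0), (0,0,0,0,0) — plus the dispatch. Nothing on crux 14610 or VP ≠ VNP.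
-/

set_option linter.dupNamespace false

namespace Summit.ValiantsHypothesis.ValiantsHypothesis.Theorems.BarrierLever.SimplexJoin

open Finset Matrix
open Summit.ValiantsHypothesis.ValiantsHypothesis.Theorems.BarrierLever.HiddenStates.UniversalConstraints
  (rowsSmallFirst rowsSmallFirst_injective card_small_rowsSmallFirst)

/-- The `n` smallest subsets of `Fin h` all have size `≤ d` as soon as `n ≤ C(h, ≤ d)`. -/
theorem smallRowsUniv_props (h d n : ℕ) (hn2 : n ≤ 2 ^ h) (hnC : n ≤ ∑ i ∈ Finset.range (d + 1), h.choose i) :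
    ∀ i, (rowsSmallFirst h (d + 1) n hn2 i).card ≤ d := by
  classical
  have hsmall := card_small_rowsSmallFirst h (d + 1) n hn2
  rw [min_eq_left hnC] at hsmall
  have heq : (Finset.univ.filter fun i : Fin n => (rowsSmallFirst h (d + 1) n hn2 i).card < d + 1) = Finset.univ :=
    Finset.eq_univ_of_card _ (le_antisymm (Finset.card_filter_le _ _ |>.trans (by simp)) (by simpa using hsmall))
  intro i
  have : i ∈ (Finset.univ.filter fun i : Fin n => (rowsSmallFirst h (d + 1) n hn2 i).card < d + 1) := by
    rw [heq]; exact Finset.mem_univ i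
  have := (Finset.mem_filter.mp this).2
  omega

/-- `n ≤ (2h)²((2h)²+1)+1` gives `n ≤ C(h,5)` (`h ≥ 2^12`), hence `n ≤ C(h, ≤ d)` for every `d ≥ 5` and `n ≤ 2^h`. -/
theorem n_le_choose_five (h n : ℕ) (hh : 2 ^ 12 ≤ h) (hnhi : n ≤ (h + h) ^ 2 * ((h + h) ^ 2 + 1) + 1) : n ≤ h.choose 5 := by
  have hC5 : (h - 4) ^ 5 ≤ 120 * h.choose 5 := by
    have h1 := Nat.pow_sub_le_descFactorial h 5
    rw [Nat.descFactorial_eq_factorial_mul_choose, show Nat.factorial 5 = 120 by rfl,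
      show h + 1 - 5 = h - 4 by omega] at h1
    exact h1
  have : 120 * n ≤ 120 * h.choose 5 := (Nat.mul_le_mul_left _ hnhi).trans ((arith_deep22 h hh).trans hC5)
  omega

/-- From `n ≤ C(h,5)`: `n ≤ Σ_{i<d+1} C(h,i)` for `d ≥ 5`. -/
theorem n_le_sum_choose (h n d : ℕ) (hn : n ≤ h.choose 5) (hd : 5 ≤ d) : n ≤ ∑ i ∈ Finset.range (d + 1), h.choose i :=
  hn.trans (Finset.single_le_sum (f := fun i => h.choose i) (fun i _ => Nat.zero_le _) (Finset.mem_range.mpr (by omega)))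

variable {D N n : ℕ}

/-- **Six or more live slots.** -/
theorem pieceKill_sixLive (h : ℕ) (hh : 2 ^ 12 ≤ h) (S : Fin 1 → Fin D → Finset (Fin N))
    (e : Fin n → Fin 1 × (Fin D → Option (Fin N))) (he : Function.Injective e)
    (hlive : ∀ c : Fin 1 × (Fin D → Option (Fin N)),
      c ∈ Set.range e ↔ ∀ (f : Fin D) (j : Fin N), c.2 f = some j → j ∈ S c.1 f)
    (hsix : 6 ≤ (Finset.univ.filter fun f : Fin D => (S 0 f).Nonempty).card)
    (hnhi : n ≤ (h + h) ^ 2 * ((h + h) ^ 2 + 1) + 1) :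
    ∃ v : Fin n → Finset (Fin h), Function.Injective v ∧
      ∀ T : Fin 1 → Option (Fin D × Fin N) → Fin h → ℂ,
        (Matrix.of fun x x' : Fin n => ∏ a ∈ v x,
          (T (e x').1 none a + ∑ f : Fin D, ((e x').2 f).elim 0 fun j => T (e x').1 (some (f, j)) a)).det = 0 := by
  classical
  obtain ⟨t, ht, htcard⟩ := Finset.le_card_iff_exists_subset_card.mp hsix
  let g : Fin 6 ↪o Fin D := t.orderEmbOfFin htcard
  have hg : ∀ i, (S 0 (g i)).Nonempty := fun i =>
    (Finset.mem_filter.mp (ht (t.orderEmbOfFin_mem htcard i))).2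
  have hgi : ∀ i j : Fin 6, i ≠ j → g i ≠ g j := fun i j hij hgij => hij (g.injective hgij)
  have hn5 := n_le_choose_five h n hh hnhi
  have hn2 : n ≤ 2 ^ h := hn5.trans (Nat.choose_le_two_pow h 5)
  have hrows := smallRowsUniv_props h 5 n hn2 (n_le_sum_choose h n 5 hn5 le_rfl)
  refine ⟨rowsSmallFirst h 6 n hn2, rowsSmallFirst_injective h 6 n hn2, fun T => ?_⟩
  have hl : ∀ i, ∑ k ∈ Finset.range (0 + 1), (Finset.univ : Finset (Fin h)).card.choose k ≤ (S 0 (g i)).card := fun i => by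
    simpa using Finset.card_pos.mpr (hg i)
  exact det_eq_zero_of_six_slots_levels h 0 0 0 0 0 0 1 D N n Finset.univ (rowsSmallFirst h 6 n hn2)
    (fun i => Finset.subset_univ _) (fun i => by simpa using hrows i) S e he hlive 0 (g 0) (g 1) (g 2) (g 3) (g 4) (g 5)
    (hgi 0 1 (by decide)) (hgi 0 2 (by decide)) (hgi 0 3 (by decide)) (hgi 0 4 (by decide)) (hgi 0 5 (by decide))
    (hgi 1 2 (by decide)) (hgi 1 3 (by decide)) (hgi 1 4 (by decide)) (hgi 1 5 (by decide)) (hgi 2 3 (by decide))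
    (hgi 2 4 (by decide)) (hgi 2 5 (by decide)) (hgi 3 4 (by decide)) (hgi 3 5 (by decide)) (hgi 4 5 (by decide))
    (hl 0) (hl 1) (hl 2) (hl 3) (hl 4) (hl 5) T

/-- **Three slots deep enough** (`m₁ + m₂ + m₃ ≥ 3`, levels at `univ`). -/
theorem pieceKill_deep3 (h m₁ m₂ m₃ : ℕ) (hh : 2 ^ 12 ≤ h) (hm : 3 ≤ m₁ + m₂ + m₃) (S : Fin 1 → Fin D → Finset (Fin N))
    (e : Fin n → Fin 1 × (Fin D → Option (Fin N))) (he : Function.Injective e)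
    (hlive : ∀ c : Fin 1 × (Fin D → Option (Fin N)),
      c ∈ Set.range e ↔ ∀ (f : Fin D) (j : Fin N), c.2 f = some j → j ∈ S c.1 f)
    (f₁ f₂ f₃ : Fin D) (h12 : f₁ ≠ f₂) (h13 : f₁ ≠ f₃) (h23 : f₂ ≠ f₃)
    (hS₁ : ∑ i ∈ Finset.range (m₁ + 1), h.choose i ≤ (S 0 f₁).card)
    (hS₂ : ∑ i ∈ Finset.range (m₂ + 1), h.choose i ≤ (S 0 f₂).card)
    (hS₃ : ∑ i ∈ Finset.range (m₃ + 1), h.choose i ≤ (S 0 f₃).card)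
    (hnhi : n ≤ (h + h) ^ 2 * ((h + h) ^ 2 + 1) + 1) :
    ∃ v : Fin n → Finset (Fin h), Function.Injective v ∧
      ∀ T : Fin 1 → Option (Fin D × Fin N) → Fin h → ℂ,
        (Matrix.of fun x x' : Fin n => ∏ a ∈ v x,
          (T (e x').1 none a + ∑ f : Fin D, ((e x').2 f).elim 0 fun j => T (e x').1 (some (f, j)) a)).det = 0 := by
  classical
  have hn5 := n_le_choose_five h n hh hnhi
  have hn2 : n ≤ 2 ^ h := hn5.trans (Nat.choose_le_two_pow h 5)
  have hrows := smallRowsUniv_props h (m₁ + m₂ + m₃ + 2) n hn2 (n_le_sum_choose h n _ hn5 (by omega))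
  refine ⟨rowsSmallFirst h (m₁ + m₂ + m₃ + 2 + 1) n hn2, rowsSmallFirst_injective h _ n hn2, fun T => ?_⟩
  exact det_eq_zero_of_three_slots_levels h m₁ m₂ m₃ 1 D N n Finset.univ _ (fun i => Finset.subset_univ _) hrows
    S e he hlive 0 f₁ f₂ f₃ h12 h13 h23 (by simpa using hS₁) (by simpa using hS₂) (by simpa using hS₃) T

/-- **Four slots deep enough** (`m₁ + m₂ + m₃ + m₄ ≥ 2`, levels at `univ`). -/
theorem pieceKill_deep4 (h m₁ m₂ m₃ m₄ : ℕ) (hh : 2 ^ 12 ≤ h) (hm : 2 ≤ m₁ + m₂ + m₃ + m₄) (S : Fin 1 → Fin D → Finset (Fin N))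
    (e : Fin n → Fin 1 × (Fin D → Option (Fin N))) (he : Function.Injective e)
    (hlive : ∀ c : Fin 1 × (Fin D → Option (Fin N)),
      c ∈ Set.range e ↔ ∀ (f : Fin D) (j : Fin N), c.2 f = some j → j ∈ S c.1 f)
    (f₁ f₂ f₃ f₄ : Fin D) (h12 : f₁ ≠ f₂) (h13 : f₁ ≠ f₃) (h14 : f₁ ≠ f₄) (h23 : f₂ ≠ f₃) (h24 : f₂ ≠ f₄) (h34 : f₃ ≠ f₄)
    (hS₁ : ∑ i ∈ Finset.range (m₁ + 1), h.choose i ≤ (S 0 f₁).card)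
    (hS₂ : ∑ i ∈ Finset.range (m₂ + 1), h.choose i ≤ (S 0 f₂).card)
    (hS₃ : ∑ i ∈ Finset.range (m₃ + 1), h.choose i ≤ (S 0 f₃).card)
    (hS₄ : ∑ i ∈ Finset.range (m₄ + 1), h.choose i ≤ (S 0 f₄).card)
    (hnhi : n ≤ (h + h) ^ 2 * ((h + h) ^ 2 + 1) + 1) :
    ∃ v : Fin n → Finset (Fin h), Function.Injective v ∧
      ∀ T : Fin 1 → Option (Fin D × Fin N) → Fin h → ℂ,
        (Matrix.of fun x x' : Fin n => ∏ a ∈ v x,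
          (T (e x').1 none a + ∑ f : Fin D, ((e x').2 f).elim 0 fun j => T (e x').1 (some (f, j)) a)).det = 0 := by
  classical
  have hn5 := n_le_choose_five h n hh hnhi
  have hn2 : n ≤ 2 ^ h := hn5.trans (Nat.choose_le_two_pow h 5)
  have hrows := smallRowsUniv_props h (m₁ + m₂ + m₃ + m₄ + 3) n hn2 (n_le_sum_choose h n _ hn5 (by omega))
  refine ⟨rowsSmallFirst h (m₁ + m₂ + m₃ + m₄ + 3 + 1) n hn2, rowsSmallFirst_injective h _ n hn2, fun T => ?_⟩
  exact det_eq_zero_of_four_slots_levels h m₁ m₂ m₃ m₄ 1 D N n Finset.univ _ (fun i => Finset.subset_univ _) hrows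
    S e he hlive 0 f₁ f₂ f₃ f₄ h12 h13 h14 h23 h24 h34
    (by simpa using hS₁) (by simpa using hS₂) (by simpa using hS₃) (by simpa using hS₄) T

/-- **Five slots deep enough** (`m₁ + … + m₅ ≥ 1`, levels at `univ`). -/
theorem pieceKill_deep5 (h m₁ m₂ m₃ m₄ m₅ : ℕ) (hh : 2 ^ 12 ≤ h) (hm : 1 ≤ m₁ + m₂ + m₃ + m₄ + m₅)
    (S : Fin 1 → Fin D → Finset (Fin N))
    (e : Fin n → Fin 1 × (Fin D → Option (Fin N))) (he : Function.Injective e)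
    (hlive : ∀ c : Fin 1 × (Fin D → Option (Fin N)),
      c ∈ Set.range e ↔ ∀ (f : Fin D) (j : Fin N), c.2 f = some j → j ∈ S c.1 f)
    (f₁ f₂ f₃ f₄ f₅ : Fin D) (h12 : f₁ ≠ f₂) (h13 : f₁ ≠ f₃) (h14 : f₁ ≠ f₄) (h15 : f₁ ≠ f₅) (h23 : f₂ ≠ f₃) (h24 : f₂ ≠ f₄)
    (h25 : f₂ ≠ f₅) (h34 : f₃ ≠ f₄) (h35 : f₃ ≠ f₅) (h45 : f₄ ≠ f₅)
    (hS₁ : ∑ i ∈ Finset.range (m₁ + 1), h.choose i ≤ (S 0 f₁).card)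
    (hS₂ : ∑ i ∈ Finset.range (m₂ + 1), h.choose i ≤ (S 0 f₂).card)
    (hS₃ : ∑ i ∈ Finset.range (m₃ + 1), h.choose i ≤ (S 0 f₃).card)
    (hS₄ : ∑ i ∈ Finset.range (m₄ + 1), h.choose i ≤ (S 0 f₄).card)
    (hS₅ : ∑ i ∈ Finset.range (m₅ + 1), h.choose i ≤ (S 0 f₅).card)
    (hnhi : n ≤ (h + h) ^ 2 * ((h + h) ^ 2 + 1) + 1) :
    ∃ v : Fin n → Finset (Fin h), Function.Injective v ∧
      ∀ T : Fin 1 → Option (Fin D × Fin N) → Fin h → ℂ,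
        (Matrix.of fun x x' : Fin n => ∏ a ∈ v x,
          (T (e x').1 none a + ∑ f : Fin D, ((e x').2 f).elim 0 fun j => T (e x').1 (some (f, j)) a)).det = 0 := by
  classical
  have hn5 := n_le_choose_five h n hh hnhi
  have hn2 : n ≤ 2 ^ h := hn5.trans (Nat.choose_le_two_pow h 5)
  have hrows := smallRowsUniv_props h (m₁ + m₂ + m₃ + m₄ + m₅ + 4) n hn2 (n_le_sum_choose h n _ hn5 (by omega))
  refine ⟨rowsSmallFirst h (m₁ + m₂ + m₃ + m₄ + m₅ + 4 + 1) n hn2, rowsSmallFirst_injective h _ n hn2, fun T => ?_⟩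
  exact det_eq_zero_of_five_slots_levels h m₁ m₂ m₃ m₄ m₅ 1 D N n Finset.univ _ (fun i => Finset.subset_univ _) hrows
    S e he hlive 0 f₁ f₂ f₃ f₄ f₅ h12 h13 h14 h15 h23 h24 h25 h34 h35 h45
    (by simpa using hS₁) (by simpa using hS₂) (by simpa using hS₃) (by simpa using hS₄) (by simpa using hS₅) T

end Summit.ValiantsHypothesis.ValiantsHypothesis.Theorems.BarrierLever.SimplexJoin
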